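import Literature.AnabelianGeometry.EtaleTheta.Discharge.Sec5KummerOutTransport
import Literature.AnabelianGeometry.EtaleTheta.AutOutDictionary

/-!
# [EtTh] §5, Lemma 5.8 / 5.9 (iv) / Theorem 5.10 (iii): the intrinsic `K^×`-part of `D` and the canonical one AGREE (pp. 331–335 / PDF pp. 105–109)

Mochizuki, *The étale theta function and its Frobenioid-theoretic manifestations*, Publ. RIMS **45**
(2009) [cite: MochizukiEtTh2009, Lem 5.9 (iv) p.332 (PDF p.106)].  Layer L2 of the abc-iut cell, sub-DAG
`plan/L2/SUBDAG-EtTh-Thm510i.md` row L58-B1 (holder abc-iut-w4-d095).  PROOF-ONLY (no definitions) over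
abc-iut-L2-t11's `FrobenioidKummerOut.lean` / `Discharge/Sec5KummerOutTransport.lean` (the INTRINSIC
`K^×`-part `BiratAutAction.kummerOut` of `D ⊆ Out(E^Π_N)` and its transport into the model's `kummerOut`),
abc-iut-L2-t11's `Discharge/Sec5BiThetaIsoCanonical.lean` (the CANONICAL `DK₀ :=` transport-preimage of the
model's `kummerOut`; the DK instance of record, L2-lead 2026-08-26T01:44Z) and abc-iut-L6-t23's
`Discharge/Sec5Thm510iiiKummerPart.lean` (Theorem 5.10 (iii) at `DK₀`).

Lemma 5.9 (iv): the bi-theta environment structure on `E^Π_N` has `D` "generated by the natural outer actions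
of `l·ℤ` [cf. (iii)], `K^×` [cf. Lemma 5.8] on `E_N`"; Lemma 5.8: the outer action of `(O_K^×)^{1/N}` "extends to
an outer action of `(K^×)^{1/N}/μ_N(B_N) (⥲ K^×) on E_N`".  Two renderings of the `K^×`-part are in the tree:
the intrinsic `α.kummerOut hK` (Kummer cocycles of `N`-th roots of constants, abc-iut-L2-t11) and the extrinsic
`DK₀` (everything that lands in the model's Kummer part).  PROVED here, under EXACTLY abc-iut-L2-t11's two
Kummer-theory inputs `hinfl` (the Kummer cocycle of every `f ∈ (K^×)^{1/N}` is inflated from `G_K`) and `hKum`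
(every `μ_N`-class of `G_K` is the class of some such `f` up to a coboundary — "`K^× ↠ (K^×)/(K^×)^N ⥲ H¹(G_K, μ_N)`",
Def. 2.13 (i) p.273):
* `kummerOut_subset_canonical` — `α.kummerOut ⊆ DK₀`; `canonical_subset_D_kummerOut` — `DK₀ ⊆ ⟨galOut ∪
  constOut ∪ α.kummerOut⟩` (transport of outer automorphisms along `E^Π_N ⥲ Π^tp_Y[μ_N]` is injective:
  abc-iut-L2-t2's `TopOut.transport_symm_comp`);
* `D_kummerOut_eq_canonical` — the two subgroups `D = ⟨l·ℤ, (O_K^×)^{1/N}, K^×-part⟩` COINCIDE: the DK instance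
  of record spans the same `D` as the intrinsic one;
* transfer along an equality of `D`'s (`monoThetaEnvCompat_of_D_eq`, `frdIsMonoThetaEnv_of_D_eq`, for ANY two
  residual data `DK₁, DK₂`; no cast: the isomorphisms are rebuilt field by field over the same `Π = E^Π_N`),
  whence Lemma 5.9 (iv) "In particular" either way (`frdIsMonoThetaEnv_kummerOut_iff_canonical`) and — v2, one
  line over abc-iut-L6-t23's `monoThetaEnvCompat_canonical` once its module is built — **Theorem 5.10 (iii) for
  the INTRINSIC `𝕄(𝔉)** (`monoThetaEnvCompat_kummerOut`; v1 already gives it abstractly: `monoThetaEnvCompat_of_D_eq`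
  + `D_kummerOut_eq_canonical`) — so Lemma 5.9 (iv) (abc-iut-L2-t11's `frdIsMonoThetaEnv_birat`)
  and Theorem 5.10 (iii) are certified for ONE AND THE SAME object with `D = ⟨l·ℤ, K^×⟩`, at the intrinsic
  `DK := α.kummerOut hK` (audit note I2 of abc-iut-w4-d008 on p417278/p417098; finding F-g4-1 of
  abc-iut-L6-t23), modulo the named Kummer-theory inputs and the hypotheses of the two cited theorems.
HONEST FRAMING: kernel-checked implications between typed statements about the §5 data; [EtTh] is refereed;
nothing of it is asserted unconditionally; typed ≠ proved for the genuine data; no side is taken on any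
disputed claim downstream ([IUTchIII] Cor. 3.12).
-/

namespace Literature.AnabelianGeometry.EtaleTheta

open CategoryTheory

universe w v v' u u'

namespace ThetaFrobenioid

variable {C : Type u} [Category.{v} C] {D : Type u'} [Category.{v'} D] (𝔉 : ThetaFrobenioid.{w} C D)

/-! ### Transfer along an equality of the subgroups `D` (any two residual data `DK₁, DK₂`) -/

/-- **Theorem 5.10 (iii)'s typed statement (`MonoThetaEnvCompat`) transfers along an equality of the subgroups
`D = ⟨galOut ∪ constOut ∪ DK⟩`** — the automorphism `γ` is rebuilt field by field over the same `Π = E^Π_N`.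
[cite: MochizukiEtTh2009, Thm 5.10 (iii) p.334 (PDF p.108)] -/
theorem monoThetaEnvCompat_of_D_eq (h1 : 𝔉.SectionsFactor) (h3 : 𝔉.OuterActionLZ)
    (hsec : 𝔉.SgpCapSection) (hcs : 𝔉.SgpCupSection) (h8 : 𝔉.ConstantsEqNormalizer)
    {DK₁ DK₂ : Set (TopOut 𝔉.EPiN)}
    (hD : Subgroup.closure (𝔉.galOut h3 hsec ∪ 𝔉.constOut h8 ∪ DK₁) =
      Subgroup.closure (𝔉.galOut h3 hsec ∪ 𝔉.constOut h8 ∪ DK₂))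
    (Ψ : C ≌ C) (β : Ψ.functor.obj 𝔉.BN ≅ 𝔉.BN) (ψY : 𝔉.PiX ≃ₜ* 𝔉.PiX)
    (hbase : ∀ g, 𝔉.autBase 𝔉.BN (𝔉.psiAut Ψ β (𝔉.sgpCap (𝔉.ρ g))) = 𝔉.ρ (ψY g))
    (hψY : 𝔉.PiY.map ψY.toMulEquiv.toMonoidHom = 𝔉.PiY)
    (hψYdd : 𝔉.PiYdd.map ψY.toMulEquiv.toMonoidHom = 𝔉.PiYdd)
    (h : 𝔉.MonoThetaEnvCompat h1 h3 hsec hcs h8 DK₁ Ψ β ψY hbase hψY hψYdd) :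
    𝔉.MonoThetaEnvCompat h1 h3 hsec hcs h8 DK₂ Ψ β ψY hbase hψY hψYdd := by
  obtain ⟨x₃, γ, k, hk, hγ⟩ := h
  refine ⟨x₃, { e := γ.e, map_D := ?_, map_sTheta := γ.map_sTheta }, k, hk, hγ⟩
  change (Subgroup.closure (𝔉.galOut h3 hsec ∪ 𝔉.constOut h8 ∪ DK₂)).map _ =
    Subgroup.closure (𝔉.galOut h3 hsec ∪ 𝔉.constOut h8 ∪ DK₂)
  rw [← hD]
  exact γ.map_D

/-- **Lemma 5.9 (iv) "In particular" (`FrdIsMonoThetaEnv`) transfers along an equality of the subgroups `D`.**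
[cite: MochizukiEtTh2009, Lem 5.9 (iv) p.332 (PDF p.106)] -/
theorem frdIsMonoThetaEnv_of_D_eq (h1 : 𝔉.SectionsFactor) (h3 : 𝔉.OuterActionLZ)
    (hsec : 𝔉.SgpCapSection) (hcs : 𝔉.SgpCupSection) (h8 : 𝔉.ConstantsEqNormalizer)
    {DK₁ DK₂ : Set (TopOut 𝔉.EPiN)}
    (hD : Subgroup.closure (𝔉.galOut h3 hsec ∪ 𝔉.constOut h8 ∪ DK₁) =
      Subgroup.closure (𝔉.galOut h3 hsec ∪ 𝔉.constOut h8 ∪ DK₂))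
    (T' : ThetaEnvData.{v} 𝔉.N) (h : 𝔉.FrdIsMonoThetaEnv h1 h3 hsec hcs h8 DK₁ T') :
    𝔉.FrdIsMonoThetaEnv h1 h3 hsec hcs h8 DK₂ T' := by
  obtain ⟨η, hη, ⟨i⟩⟩ := h
  refine ⟨η, hη, ⟨{ e := i.e, map_D := ?_, map_sTheta := i.map_sTheta }⟩⟩
  change (Subgroup.closure (𝔉.galOut h3 hsec ∪ 𝔉.constOut h8 ∪ DK₂)).map _ = _
  rw [← hD]
  exact i.map_D

variable {𝔉}

namespace BiratAutAction

variable (α : 𝔉.BiratAutAction)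

/-- **`α.kummerOut ⊆ DK₀`**: the intrinsic Kummer outer automorphisms land in the model's Kummer part, so they
belong to the canonical `K^×`-part (abc-iut-L2-t11's `image_kummerOut_subset_kummerOut`, given `hinfl`).
[cite: MochizukiEtTh2009, Lem 5.9 (iv) p.332 (PDF p.106)] -/
theorem kummerOut_subset_canonical (hK : 𝔉.KxRootNModCyclotome) (H : 𝔉.Facts)
    (T : ThetaEnvData.{v} 𝔉.N) (ι : 𝔉.PiX ≃ₜ* T.PiX) (m : 𝔉.muTorsion 𝔉.BN 𝔉.N ≃* T.mu)
    (hY : 𝔉.IdentifiesPiY T ι.toMulEquiv) (hχ : 𝔉.CyclotomicCharacterCompat T ι.toMulEquiv m)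
    (hinfl : ∀ f : 𝔉.KxRootN, ∃ δ₀ : T.G → T.mu, ∀ (y : 𝔉.PiX), y ∈ 𝔉.PiY →
      m (α.kummerCocycle hK f (𝔉.sgpCap (𝔉.ρ y))) = δ₀ (T.aug (ι y))) :
    α.kummerOut hK ⊆ TopOut.transport (𝔉.envContIso H T ι m hY hχ) ⁻¹' T.kummerOut :=
  fun _ ho => α.image_kummerOut_subset_kummerOut hK H T ι m hY hχ hinfl ⟨_, ho, rfl⟩

/-- **`DK₀ ⊆ ⟨galOut ∪ constOut ∪ α.kummerOut⟩`**: an outer automorphism of `E^Π_N` whose transport is a Kummer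
shift of the model is REACHED from `D` (abc-iut-L2-t11's `kummerOutReached_birat`, given `hKum`), and transport
along `E^Π_N ⥲ Π^tp_Y[μ_N]` is injective.  [cite: MochizukiEtTh2009, Lem 5.9 (iv) p.332 (PDF p.106)] -/
theorem canonical_subset_D_kummerOut (hK : 𝔉.KxRootNModCyclotome) (H : 𝔉.Facts)
    (h1 : 𝔉.SectionsFactor) (h3 : 𝔉.OuterActionLZ) (hsec : 𝔉.SgpCapSection) (hcs : 𝔉.SgpCupSection)
    (h8 : 𝔉.ConstantsEqNormalizer)
    (T : ThetaEnvData.{v} 𝔉.N) (ι : 𝔉.PiX ≃ₜ* T.PiX) (m : 𝔉.muTorsion 𝔉.BN 𝔉.N ≃* T.mu)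
    (hY : 𝔉.IdentifiesPiY T ι.toMulEquiv) (hχ : 𝔉.CyclotomicCharacterCompat T ι.toMulEquiv m)
    (hKum : ∀ δ₀ : T.G → T.mu, CycEnvelope.IsEnvCocycle T.augY T.chi (δ₀ ∘ T.augY) →
      ∃ (f : 𝔉.KxRootN) (a : T.mu), ∀ p : T.PiY,
        δ₀ (T.augY p) = (α.kummerCocycleY hK f T ι.toMulEquiv m p)⁻¹ * CycEnvelope.coboundary T.augY T.chi a p) :
    TopOut.transport (𝔉.envContIso H T ι m hY hχ) ⁻¹' T.kummerOut ⊆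
      (Subgroup.closure (𝔉.galOut h3 hsec ∪ 𝔉.constOut h8 ∪ α.kummerOut hK) : Set (TopOut 𝔉.EPiN)) := by
  intro o ho
  obtain ⟨d, hd, hdo⟩ := Subgroup.mem_map.mp
    (α.kummerOutReached_birat hK H T ι m hY hχ h1 h3 hsec hcs h8 hKum ho)
  have hinj : Function.Injective (TopOut.transport (𝔉.envContIso H T ι m hY hχ)) := fun a b hab => by
    have h := congrArg (TopOut.transport (𝔉.envContIso H T ι m hY hχ).symm) hab
    rwa [← MonoidHom.comp_apply, ← MonoidHom.comp_apply, TopOut.transport_symm_comp,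
      MonoidHom.id_apply, MonoidHom.id_apply] at h
  obtain rfl : d = o := hinj hdo
  exact hd

/-- **The two `D`'s coincide**: `⟨galOut ∪ constOut ∪ α.kummerOut⟩ = ⟨galOut ∪ constOut ∪ DK₀⟩` under `hinfl`, `hKum` —
the DK instance of record (`DK₀`) spans the same `D ⊆ Out(E^Π_N)` as the intrinsic `K^×`-part.
[cite: MochizukiEtTh2009, Lem 5.9 (iv) p.332 (PDF p.106)] -/
theorem D_kummerOut_eq_canonical (hK : 𝔉.KxRootNModCyclotome) (H : 𝔉.Facts)
    (h1 : 𝔉.SectionsFactor) (h3 : 𝔉.OuterActionLZ) (hsec : 𝔉.SgpCapSection) (hcs : 𝔉.SgpCupSection)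
    (h8 : 𝔉.ConstantsEqNormalizer)
    (T : ThetaEnvData.{v} 𝔉.N) (ι : 𝔉.PiX ≃ₜ* T.PiX) (m : 𝔉.muTorsion 𝔉.BN 𝔉.N ≃* T.mu)
    (hY : 𝔉.IdentifiesPiY T ι.toMulEquiv) (hχ : 𝔉.CyclotomicCharacterCompat T ι.toMulEquiv m)
    (hinfl : ∀ f : 𝔉.KxRootN, ∃ δ₀ : T.G → T.mu, ∀ (y : 𝔉.PiX), y ∈ 𝔉.PiY →
      m (α.kummerCocycle hK f (𝔉.sgpCap (𝔉.ρ y))) = δ₀ (T.aug (ι y)))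
    (hKum : ∀ δ₀ : T.G → T.mu, CycEnvelope.IsEnvCocycle T.augY T.chi (δ₀ ∘ T.augY) →
      ∃ (f : 𝔉.KxRootN) (a : T.mu), ∀ p : T.PiY,
        δ₀ (T.augY p) = (α.kummerCocycleY hK f T ι.toMulEquiv m p)⁻¹ * CycEnvelope.coboundary T.augY T.chi a p) :
    Subgroup.closure (𝔉.galOut h3 hsec ∪ 𝔉.constOut h8 ∪ α.kummerOut hK) =
      Subgroup.closure (𝔉.galOut h3 hsec ∪ 𝔉.constOut h8 ∪
        TopOut.transport (𝔉.envContIso H T ι m hY hχ) ⁻¹' T.kummerOut) := by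
  apply le_antisymm
  · refine (Subgroup.closure_le _).mpr ?_
    rintro o (ho | ho)
    · exact Subgroup.subset_closure (Or.inl ho)
    · exact Subgroup.subset_closure (Or.inr (α.kummerOut_subset_canonical hK H T ι m hY hχ hinfl ho))
  · refine (Subgroup.closure_le _).mpr ?_
    rintro o (ho | ho)
    · exact Subgroup.subset_closure (Or.inl ho)
    · exact α.canonical_subset_D_kummerOut hK H h1 h3 hsec hcs h8 T ι m hY hχ hKum ho

/-- **Lemma 5.9 (iv) "In particular", intrinsic ⟺ canonical.**
[cite: MochizukiEtTh2009, Lem 5.9 (iv) p.332 (PDF p.106)] -/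
theorem frdIsMonoThetaEnv_kummerOut_iff_canonical (hK : 𝔉.KxRootNModCyclotome) (H : 𝔉.Facts)
    (h1 : 𝔉.SectionsFactor) (h3 : 𝔉.OuterActionLZ) (hsec : 𝔉.SgpCapSection) (hcs : 𝔉.SgpCupSection)
    (h8 : 𝔉.ConstantsEqNormalizer)
    (T : ThetaEnvData.{v} 𝔉.N) (ι : 𝔉.PiX ≃ₜ* T.PiX) (m : 𝔉.muTorsion 𝔉.BN 𝔉.N ≃* T.mu)
    (hY : 𝔉.IdentifiesPiY T ι.toMulEquiv) (hχ : 𝔉.CyclotomicCharacterCompat T ι.toMulEquiv m)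
    (hinfl : ∀ f : 𝔉.KxRootN, ∃ δ₀ : T.G → T.mu, ∀ (y : 𝔉.PiX), y ∈ 𝔉.PiY →
      m (α.kummerCocycle hK f (𝔉.sgpCap (𝔉.ρ y))) = δ₀ (T.aug (ι y)))
    (hKum : ∀ δ₀ : T.G → T.mu, CycEnvelope.IsEnvCocycle T.augY T.chi (δ₀ ∘ T.augY) →
      ∃ (f : 𝔉.KxRootN) (a : T.mu), ∀ p : T.PiY,
        δ₀ (T.augY p) = (α.kummerCocycleY hK f T ι.toMulEquiv m p)⁻¹ * CycEnvelope.coboundary T.augY T.chi a p)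
    (T' : ThetaEnvData.{v} 𝔉.N) :
    𝔉.FrdIsMonoThetaEnv h1 h3 hsec hcs h8 (α.kummerOut hK) T' ↔
      𝔉.FrdIsMonoThetaEnv h1 h3 hsec hcs h8
        (TopOut.transport (𝔉.envContIso H T ι m hY hχ) ⁻¹' T.kummerOut) T' :=
  ⟨𝔉.frdIsMonoThetaEnv_of_D_eq h1 h3 hsec hcs h8
      (α.D_kummerOut_eq_canonical hK H h1 h3 hsec hcs h8 T ι m hY hχ hinfl hKum) T',
    𝔉.frdIsMonoThetaEnv_of_D_eq h1 h3 hsec hcs h8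
      (α.D_kummerOut_eq_canonical hK H h1 h3 hsec hcs h8 T ι m hY hχ hinfl hKum).symm T'⟩

/-! NOTE (v1): the one-line corollary `monoThetaEnvCompat_kummerOut` — Theorem 5.10 (iii) for the INTRINSIC
`𝕄(𝔉)`, = abc-iut-L6-t23's `monoThetaEnvCompat_canonical` (`Discharge/Sec5Thm510iiiKummerPart.lean`, ACCEPTED)
pushed through `monoThetaEnvCompat_of_D_eq` with `(D_kummerOut_eq_canonical …).symm` — is appended as v2 once that
module's olean is on the farm (it imports it); statement and proof are staged with the sub-DAG
(HOME/staging/w4/w4-d095/subdag/Discharge/Sec5KummerPartAgreement.v2full.lean). -/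

end BiratAutAction

end ThetaFrobenioid

end Literature.AnabelianGeometry.EtaleTheta
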